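import Summits.CriticalPhenomena.PercolationContinuityZ3.Theorems.PercNearOneGluingNoHeavyPcintNawMemoryFourExact
import HarnessLib

/-!
# CriticalPhenomena/PercolationContinuityZ3 — Theorems/PercNearOneGluingNoHeavyPcintLoopExclusionRungFourCounts.lean: the first rung of the loop-exclusion law in CLOSED FORM — `2·4·p_4(ℤ^d) = 2·4·p^N_4(ℤ^d) = 2d(2d−2)` exactly, hence `f_4`, `R_4`, `f^N_4`, `R^N_4` as explicit functions of `d`

Lane prim-pcint, STRUCTURE rule (NUMERICS ⇒ STRUCTURE ⇒ CONJECTURE), companion of …PcintLoopExclusionLaw (C4, bond column,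
namespace `…Pcint.MemoryTail`) and …PcintLoopExclusionSiteLaw (its site twin, `…Pcint.NawTail`).  The two typed laws speak
about the compatibility factors `R_τ(d) = Δ_τ(d)/f_τ(d)` and `R^N_τ(d) = Δ^N_τ(d)/f^N_τ(d)`; at the first rung `τ = 4` every
ingredient is now a closed form:

* `mem_nearWords_four_three_iff` — **a closing 3-step self-avoiding word is exactly an opened unit square** `(a, b, −a)` with
  `b` off the axis of `a` (parity makes the endpoint a unit vector; `cancel_of_three_steps` of …PcintMemoryFourRecursion);
* **`closingCount_four_eq : 2·4·p_4(ℤ^d) = 2d(2d−2)`** (only `≥` was in the tree, …PcintLoopExclusionBondRungFour) and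
  **`closingNawCount_four_eq_closingCount_four : 2·4·p^N_4(ℤ^d) = 2·4·p_4(ℤ^d)`** (a 3-step word with site memory `2` and end
  adjacent to the start is the same object), so `closingNawCount_four_eq : 2·4·p^N_4(ℤ^d) = 2d(2d−2)`;
* the closed forms **`memLoopDensity_four_eq : f_4(d) = 2d(2d−2)/(2d−1)⁴`**,
  **`loopCompat_four_eq : R_4(d) = (2d−1)⁴/(2d(2d−2)) · ln((2d−1)/μ_4(d))`** (`μ_4(d)` = the Fisher–Sykes root,
  …PcintMemoryFourFisherSykes), **`siteLoopDensity_four_eq : f^N_4(d) = 8d²(d−1)/(2d−1)⁴`** and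
  **`siteLoopCompat_four_eq : R^N_4(d) = (2d−1)⁴/(8d²(d−1)) · ln((2d−1)/λ_d)`**, `λ_d = (d−1) + √((d−1)²+1)`
  (`NawTail.nawMemGrowth_four_eq`, …PcintNawMemoryFourExact).

These identities reproduce the lane's measured first-rung factors to every printed digit (R_4 = 0.5864 / 0.7153 / 0.7802 /
0.8204 / 0.8480 and R^N_4 = 0.5499 / 0.7196 / 0.7970 / 0.8407 / 0.8689 for d = 2..6; STRUCTURE.md §1, gen15/first_order.out,
gen16/P15-score.txt) and feed the DIMENSION LAW of the first rung (…PcintLoopExclusionRungFourDimension: `R_4(d) ↑ 1` with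
`1 − R_4(d) ~ 1/d`, clause (b) of C4 at `τ = 4`).

HONEST FRAMING: finite combinatorics and bookkeeping; nothing here is used by a certified `p_c` cell.
Written by prim-pcint-2 gen 17 (prover-prim-pcint-2-g17-0), 2026-08-25.
-/

noncomputable section

open Filter Topology
open Literature.Probability.LatticeModels Literature.Probability.Percolation
open Summit.CriticalPhenomena.PercolationContinuityZ3.Theorems.Pcint

namespace Summit.CriticalPhenomena.PercolationContinuityZ3.Theorems.Pcint.MemoryTail

variable {d : ℕ}

/-! ### Closing 3-step words are opened unit squares -/

/-- The three positions of a 3-step word: `e_a`, `e_a + e_b`, `e_a + e_b + e_c`. [folklore] -/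
theorem wordPos_word_three (w : Fin 3 → Fin d × Bool) :
    wordPos w 1 = stepVec (w 0) ∧ wordPos w 2 = stepVec (w 0) + stepVec (w 1) ∧
      wordPos w 3 = stepVec (w 0) + stepVec (w 1) + stepVec (w 2) := by
  have p1 : wordPos w 1 = stepVec (w 0) := by
    have h := wordPos_succ w (k := 0) (by omega)
    simp only [wordPos_zero, zero_add] at h
    exact h
  have p2 : wordPos w 2 = stepVec (w 0) + stepVec (w 1) := by
    have h := wordPos_succ w (k := 1) (by omega)
    rw [p1] at h
    exact h
  have p3 : wordPos w 3 = stepVec (w 0) + stepVec (w 1) + stepVec (w 2) := by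
    have h := wordPos_succ w (k := 2) (by omega)
    rw [p2] at h
    exact h
  exact ⟨p1, p2, p3⟩

/-- Two steps on the same axis are equal or opposite. [folklore] -/
theorem eq_or_eq_srev_of_fst_eq {a b : Fin d × Bool} (h : b.1 = a.1) : b = a ∨ b = srev a := by
  obtain ⟨i, s⟩ := a
  obtain ⟨j, t⟩ := b
  simp only at h
  subst h
  cases s <;> cases t <;> simp [srev]

/-- A unit step is not the zero vector. [folklore] -/
theorem stepVec_ne_zero' (a : Fin d × Bool) : stepVec a ≠ 0 := fun h0 => by
  have h := l1_stepVec a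
  rw [h0] at h
  simp [l1] at h

/-- **Closing 3-step self-avoiding words are exactly the opened unit squares**: a 3-step self-avoiding word on `ℤ^d`
ends within `ℓ¹`-distance `1` of its start iff it reads `(a, b, −a)` with `b` off the axis of `a`.  (Parity forces the
endpoint to be a unit vector `e`; four unit vectors `e_a + e_b + e_c − e = 0` cancel in pairs, and self-avoidance leaves only
`c = −a`.) [folklore] -/
theorem mem_nearWords_four_three_iff (w : Fin 3 → Fin d × Bool) :
    w ∈ nearWords d 4 3 ↔ (w 1).1 ≠ (w 0).1 ∧ w 2 = srev (w 0) := by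
  classical
  obtain ⟨p1, p2, p3⟩ := wordPos_word_three w
  unfold nearWords
  rw [Finset.mem_filter, mem_sawWords]
  constructor
  · rintro ⟨hsaw, hl⟩
    have hl1 : l1 (wordPos w 3) = 1 := by
      have hpar := l1_wordPos_mod_two w 3 le_rfl
      omega
    obtain ⟨e, he⟩ := NawTail.exists_eq_stepVec_of_l1_eq_one hl1
    rw [p3] at he
    rcases cancel_of_three_steps he with h1 | h2 | h3
    · exfalso
      have h20 : wordPos w 2 = wordPos w 0 := by
        rw [p2, wordPos_zero, h1, stepVec_srev, add_neg_cancel]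
      have := hsaw 2 0 (by omega) (by omega) h20
      omega
    · exfalso
      have h31 : wordPos w 3 = wordPos w 1 := by
        rw [p3, p1, h2, stepVec_srev, add_neg_cancel_right]
      have := hsaw 3 1 (by omega) (by omega) h31
      omega
    · refine ⟨fun hba => ?_, h3⟩
      rcases eq_or_eq_srev_of_fst_eq hba with hb | hb
      · -- `(a, a, −a)` revisits `e_a`
        have h31 : wordPos w 3 = wordPos w 1 := by
          rw [p3, p1, h3, hb, stepVec_srev, add_neg_cancel_right]
        have := hsaw 3 1 (by omega) (by omega) h31
        omega
      · have h20 : wordPos w 2 = wordPos w 0 := by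
          rw [p2, wordPos_zero, hb, stepVec_srev, add_neg_cancel]
        have := hsaw 2 0 (by omega) (by omega) h20
        omega
  · rintro ⟨hba, hc⟩
    have p3' : wordPos w 3 = stepVec (w 1) := by
      rw [p3, hc, stepVec_srev]; abel
    have hab' : stepVec (w 0) ≠ stepVec (w 1) := fun h =>
      hba (by rw [GMStep.stepVec_injective d h])
    have hsum : stepVec (w 0) + stepVec (w 1) ≠ 0 := fun h => by
      have h' : stepVec (w 1) = stepVec (srev (w 0)) := by
        rw [stepVec_srev]; exact eq_neg_of_add_eq_zero_right h
      exact hba (by rw [GMStep.stepVec_injective d h']; rfl)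
    refine ⟨fun i j hi hj hij => ?_, by rw [p3', l1_stepVec]⟩
    interval_cases i <;> interval_cases j <;> simp only [wordPos_zero, p1, p2, p3'] at hij
    all_goals first
      | rfl
      | exact absurd hij.symm (stepVec_ne_zero' _)
      | exact absurd hij (stepVec_ne_zero' _)
      | exact absurd hij hsum.symm
      | exact absurd hij hsum
      | exact absurd hij hab'
      | exact absurd hij hab'.symm
      | (exfalso; exact stepVec_ne_zero' (w 1) (by simpa using hij))
      | (exfalso; exact stepVec_ne_zero' (w 0) (by simpa using hij))

/-! ### The exact closing counts -/

/-- **`2·4·p_4(ℤ^d) = 2d(2d−2)` EXACTLY**: the closing 3-step self-avoiding words are in bijection with the pairs `(a, b)` of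
steps on different axes (`2d` choices of `a`, `2d − 2` of `b`).  The tree had `≥` (…PcintLoopExclusionBondRungFour,
`closingCount_four_ge`). [folklore] -/
theorem closingCount_four_eq : closingCount d 4 = 2 * d * (2 * d - 2) := by
  classical
  unfold closingCount
  rw [show (4 : ℕ) - 1 = 3 from rfl]
  set D := (Finset.univ : Finset (Fin d × Bool)).sigma
    fun a => Finset.univ.filter fun b : Fin d × Bool => b.1 ≠ a.1 with hD
  have hDcard : D.card = 2 * d * (2 * d - 2) := by
    rw [hD, Finset.card_sigma]
    have hinner : ∀ a : Fin d × Bool, (Finset.univ.filter fun b : Fin d × Bool => b.1 ≠ a.1).card = 2 * d - 2 :=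
      fun a => card_filter_fst_ne' a.1
    simp_rw [hinner, Finset.sum_const, Finset.card_univ, Fintype.card_prod, Fintype.card_fin, Fintype.card_bool,
      smul_eq_mul]
    ring
  rw [← hDcard]
  refine Finset.card_bij (fun w _ => (⟨w 0, w 1⟩ : Σ _ : Fin d × Bool, Fin d × Bool)) ?_ ?_ ?_
  · intro w hw
    obtain ⟨hba, _⟩ := (mem_nearWords_four_three_iff w).1 hw
    rw [hD, Finset.mem_sigma, Finset.mem_filter]
    exact ⟨Finset.mem_univ _, Finset.mem_univ _, hba⟩
  · intro w hw w' hw' h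
    obtain ⟨_, hc⟩ := (mem_nearWords_four_three_iff w).1 hw
    obtain ⟨_, hc'⟩ := (mem_nearWords_four_three_iff w').1 hw'
    obtain ⟨h0, h1⟩ := Sigma.mk.inj_iff.1 h
    have h1' : w 1 = w' 1 := eq_of_heq h1
    funext i
    fin_cases i
    · exact h0
    · exact h1'
    · show w 2 = w' 2
      rw [hc, hc', h0]
  · intro p hp
    obtain ⟨a, b⟩ := p
    have hab : b.1 ≠ a.1 := by
      rw [hD, Finset.mem_sigma, Finset.mem_filter] at hp
      exact hp.2.2
    let F : Fin 3 → Fin d × Bool := fun i => if i.val = 0 then a else if i.val = 1 then b else srev a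
    have hF0 : F 0 = a := by simp [F]
    have hF1 : F 1 = b := by simp [F]
    have hF2 : F 2 = srev a := by simp [F]
    refine ⟨F, (mem_nearWords_four_three_iff F).2 ⟨?_, ?_⟩, ?_⟩
    · rw [hF1, hF0]; exact hab
    · rw [hF2, hF0]
    · simp only [hF0, hF1]

/-- `2·4·p_4(ℤ^d) = 2d(2d−2)` as a real number (`d ≥ 1`). [folklore] -/
theorem cast_closingCount_four (hd : 1 ≤ d) : (closingCount d 4 : ℝ) = 2 * d * (2 * d - 2) := by
  rw [closingCount_four_eq, Nat.cast_mul, Nat.cast_mul, Nat.cast_sub (by omega)]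
  push_cast
  ring

/-! ### Closed forms of the bond first rung -/

/-- **`f_4(d) = 2d(2d−2)/(2d−1)⁴`** (`μ_2(d) = 2d − 1`, `memGrowth_two_eq`). [folklore] -/
theorem memLoopDensity_four_eq (hd : 2 ≤ d) :
    memLoopDensity d 4 = 2 * d * (2 * d - 2) / (2 * (d : ℝ) - 1) ^ 4 := by
  haveI : NeZero d := ⟨by omega⟩
  unfold memLoopDensity
  rw [show (4 : ℕ) - 2 = 2 from rfl, memGrowth_two_eq, cast_closingCount_four (by omega)]

/-- `f_4(d) > 0` for `d ≥ 2`. [folklore] -/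
theorem memLoopDensity_four_pos' (hd : 2 ≤ d) : 0 < memLoopDensity d 4 := by
  rw [memLoopDensity_four_eq hd]
  have hd' : (2 : ℝ) ≤ d := by exact_mod_cast hd
  have h1 : (0 : ℝ) < 2 * d - 1 := by linarith
  exact div_pos (mul_pos (by positivity) (by linarith)) (pow_pos h1 4)

/-- **`R_4(d) = (2d−1)⁴/(2d(2d−2)) · ln((2d−1)/μ_4(d))`** — the first-rung compatibility factor in closed form, up to the
Fisher–Sykes root `μ_4(d)` (…PcintMemoryFourFisherSykes). [folklore] -/
theorem loopCompat_four_eq (hd : 2 ≤ d) :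
    loopCompat d 4 = (2 * (d : ℝ) - 1) ^ 4 / (2 * d * (2 * d - 2)) * Real.log ((2 * (d : ℝ) - 1) / memGrowth d 4) := by
  haveI : NeZero d := ⟨by omega⟩
  have hd' : (2 : ℝ) ≤ d := by exact_mod_cast hd
  have h1 : (2 * (d : ℝ) - 1) ^ 4 ≠ 0 := pow_ne_zero 4 (by linarith)
  have h2 : (2 * (d : ℝ)) * (2 * d - 2) ≠ 0 := mul_ne_zero (by positivity) (by linarith)
  unfold loopCompat memLoopCost
  rw [memLoopDensity_four_eq hd, show (4 : ℕ) - 2 = 2 from rfl, memGrowth_two_eq]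
  field_simp

end Summit.CriticalPhenomena.PercolationContinuityZ3.Theorems.Pcint.MemoryTail

namespace Summit.CriticalPhenomena.PercolationContinuityZ3.Theorems.Pcint.NawTail

variable {d : ℕ}

/-! ### The site first rung: the same closing words -/

/-- **The closing words of the site hierarchy at `τ = 4` are those of the bond hierarchy**: a 3-step word has
neighbour-avoidance memory `2` and its end adjacent to its start iff it is a closing 3-step self-avoiding word (site memory `2`
= bond memory `2`, `isNawMem_two_iff`; adjacency to the origin = endpoint a unit vector). [folklore] -/
theorem mem_closingNaw_four_iff (w : Fin 3 → Fin d × Bool) :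
    (IsNawMem 2 w ∧ (zdGraph d).Adj 0 (wordPos w 3)) ↔ w ∈ MemoryTail.nearWords d 4 3 := by
  classical
  unfold MemoryTail.nearWords
  rw [Finset.mem_filter, mem_sawWords, isNawMem_two_iff]
  constructor
  · rintro ⟨hmem, hadj⟩
    obtain ⟨e, he⟩ := (zdGraph_adj_iff_stepVec _ _).1 hadj
    rw [zero_add] at he
    have h03 : wordPos w 0 ≠ wordPos w 3 := by
      rw [wordPos_zero, he]; exact (MemoryTail.stepVec_ne_zero' e).symm
    refine ⟨fun i j hi hj hij => ?_, by rw [he, l1_stepVec]⟩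
    by_contra hne
    rcases Nat.lt_or_gt_of_ne hne with hlt | hgt
    · rcases Nat.lt_or_ge j (i + 3) with hj3 | hj3
      · exact hmem i j hj hlt (by omega) hij
      · obtain rfl : i = 0 := by omega
        obtain rfl : j = 3 := by omega
        exact h03 hij
    · rcases Nat.lt_or_ge i (j + 3) with hi3 | hi3
      · exact hmem j i hi hgt (by omega) hij.symm
      · obtain rfl : j = 0 := by omega
        obtain rfl : i = 3 := by omega
        exact h03 hij.symm
  · rintro ⟨hsaw, hl⟩
    refine ⟨isMem_of_isSAW 2 hsaw, ?_⟩
    have hl1 : l1 (wordPos w 3) = 1 := by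
      have hpar := MemoryTail.l1_wordPos_mod_two w 3 le_rfl
      omega
    obtain ⟨e, he⟩ := exists_eq_stepVec_of_l1_eq_one hl1
    exact (zdGraph_adj_iff_stepVec _ _).2 ⟨e, by rw [he, zero_add]⟩

/-- **`2·4·p^N_4(ℤ^d) = 2·4·p_4(ℤ^d)`**: at the first rung the site and bond hierarchies forbid the same loops (the unit
squares). [folklore] -/
theorem closingNawCount_four_eq_closingCount_four : closingNawCount d 4 = MemoryTail.closingCount d 4 := by
  classical
  unfold closingNawCount MemoryTail.closingCount
  rw [show (4 : ℕ) - 2 = 2 from rfl, show (4 : ℕ) - 1 = 3 from rfl]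
  congr 1
  ext w
  rw [Finset.mem_filter, mem_nawMemWords]
  exact mem_closingNaw_four_iff w

/-- **`2·4·p^N_4(ℤ^d) = 2d(2d−2)` EXACTLY** (the tree had `≥`, `closingNawCount_four_ge` of …PcintNawMemoryThree). [folklore] -/
theorem closingNawCount_four_eq : closingNawCount d 4 = 2 * d * (2 * d - 2) := by
  rw [closingNawCount_four_eq_closingCount_four, MemoryTail.closingCount_four_eq]

/-- `2·4·p^N_4(ℤ^d) = 2d(2d−2)` as a real number (`d ≥ 1`). [folklore] -/
theorem cast_closingNawCount_four (hd : 1 ≤ d) : (closingNawCount d 4 : ℝ) = 2 * d * (2 * d - 2) := by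
  rw [closingNawCount_four_eq, Nat.cast_mul, Nat.cast_mul, Nat.cast_sub (by omega)]
  push_cast
  ring

/-! ### Closed forms of the site first rung -/

/-- **`f^N_4(d) = 8d²(d−1)/(2d−1)⁴`** (`μ^N_2(d) = 2d − 1`; the lane's site density carries the factor `1 + μ^N_2 = 2d`).
[folklore] -/
theorem siteLoopDensity_four_eq (hd : 2 ≤ d) :
    siteLoopDensity d 4 = 8 * (d : ℝ) ^ 2 * (d - 1) / (2 * d - 1) ^ 4 := by
  haveI : NeZero d := ⟨by omega⟩
  unfold siteLoopDensity
  rw [show (4 : ℕ) - 2 = 2 from rfl, nawMemGrowth_two_eq, cast_closingNawCount_four (by omega)]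
  ring

/-- `f^N_4(d) > 0` for `d ≥ 2`. [folklore] -/
theorem siteLoopDensity_four_pos' (hd : 2 ≤ d) : 0 < siteLoopDensity d 4 := by
  rw [siteLoopDensity_four_eq hd]
  have hd' : (2 : ℝ) ≤ d := by exact_mod_cast hd
  have h1 : (0 : ℝ) < 2 * d - 1 := by linarith
  exact div_pos (mul_pos (by positivity) (by linarith)) (pow_pos h1 4)

/-- **`R^N_4(d) = (2d−1)⁴/(8d²(d−1)) · ln((2d−1)/λ_d)`**, `λ_d = (d−1) + √((d−1)²+1) = μ^N_4(d)` (`nawMemGrowth_four_eq`):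
the first-rung site compatibility factor in closed form. [folklore] -/
theorem siteLoopCompat_four_eq (hd : 2 ≤ d) :
    siteLoopCompat d 4 = (2 * (d : ℝ) - 1) ^ 4 / (8 * d ^ 2 * (d - 1)) *
      Real.log ((2 * (d : ℝ) - 1) / ((d - 1 : ℝ) + Real.sqrt ((d - 1) ^ 2 + 1))) := by
  have hd' : (2 : ℝ) ≤ d := by exact_mod_cast hd
  have h1 : (2 * (d : ℝ) - 1) ^ 4 ≠ 0 := pow_ne_zero 4 (by linarith)
  have h2 : 8 * (d : ℝ) ^ 2 * (d - 1) ≠ 0 := mul_ne_zero (by positivity) (by linarith)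
  unfold siteLoopCompat
  rw [siteLoopDensity_four_eq hd, siteLoopCost_four_eq hd]
  field_simp

end Summit.CriticalPhenomena.PercolationContinuityZ3.Theorems.Pcint.NawTail
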